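import Literature.AnabelianGeometry.SemiGraphs.CoveringRestrictComparisonProofs
import Literature.AnabelianGeometry.SemiGraphs.CoveringFull
import Literature.AnabelianGeometry.SemiGraphs.CoveringEssSurjIso
import Literature.AnabelianGeometry.SemiGraphs.CoveringStarIso
import Literature.AnabelianGeometry.SemiGraphs.FiniteEtaleCoveringGlobalDef
import Literature.AnabelianGeometry.SemiGraphs.PreimageComponentsIncidence

/-!
# Restricting the covering `𝒢_A → 𝒢` to a preimage component — proofs, II: the equivalence

Mochizuki, *Semi-graphs of anabelioids*, Publ. RIMS **42** (2006) 221–322, §2, proof of Corollary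
2.7 (i), author's manuscript p. 30 [cite: MochizukiSemiAnbd2006, Cor. 2.7(i) p.30]: the components `ℋ″`
of the restriction `ℋ′ → ℍ` of the covering attached to `A` are finite étale coverings of `𝒢_ℍ` — here:
GLOBALLY, i.e. `B(𝒢_A|_K) ≃ B(𝒢_ℍ)_{/Z_K}` compatibly with `(φ|_K)^*`.

PROOF-ONLY (abc-iut-L3-d3, row RS-cov), continuing `CoveringRestrictComparisonProofs.lean`:

* `exists_iso_extend` — an object of `B(𝒢_{A|_ℍ})` whose components off `K` are initial is (isomorphic
  to) the extension by initial objects of its restriction to `K`;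
* `restrictComparison_full`, `restrictComparison_essSurj`, `restrictComparison_isEquivalence` — the
  comparison functor `Over Z ⥤ B(𝒢_A|_K)` is an equivalence (fullness through the extension functor and
  abc-iut-L3-t5's `toCovering_full`; essential surjectivity through `toCovering_essSurj`, the base change
  `Over.pullback m` and the counit inversion of part I);
* `isClopenIn_of_isPreimageComponent` — a preimage component of a sub-graph is clopen in the preimage
  (abc-iut-L6-t17's incidence lemmas), the hypothesis `IsClopenIn` of the extension functor;
* `restrict_isGlobalCoveringOf` — **`φ|_K : 𝒢_A|_K → 𝒢_ℍ` is GLOBALLY the covering of `𝒢_ℍ` attached to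
  `Z`** (`Hom.IsGlobalCoveringOf`, abc-iut-L3-d3): `(φ|_K)^* ≅ (Z × −) ⋙ restrictComparison m`, assembled
  from `(φ|_K)^* = φ_{A|_ℍ}^* ⋙ restrict` (rfl), abc-iut-L3-t5's `pullbackFunctorIsoStarComp`, the counit
  inversion and Mathlib's `Over.starPullbackIsoStar`.

Nothing here takes a side on [IUTchIII] Cor. 3.12; typed ≠ discharged.
-/

namespace Literature.AnabelianGeometry.SemiGraphs

namespace SemiGraphOfAnabelioids

open CategoryTheory CategoryTheory.Limits CategoryTheory.PreGaloisCategory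
open Literature.AnabelianGeometry.Anabelioids

universe v₁ u₁ u

set_option backward.isDefEq.respectTransparency false

namespace BObj

variable {𝒢 : SemiGraphOfAnabelioids.{v₁, u₁, u}} (A : 𝒢.BObj) (H : 𝒢.graph.Subgraph)
  (K : A.coveringGraph.graph.Subgraph)
  (hV : K.verts ⊆ A.fibreData.proj.vertexMap ⁻¹' H.verts)
  (hE : K.edges ⊆ A.fibreData.proj.edgeMap ⁻¹' H.edges) (hcl : A.IsClopenIn H K)
  {Z : (𝒢.restrict H).BObj} (m : Z ⟶ (𝒢.restrictFunctor H).obj A)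
  (hmS : ∀ (w : H.toSemiGraph.Vertex) (Fw : 𝒢.V w.1 ⥤ FintypeCat.{v₁}) [FiberFunctor Fw]
      (y : Fw.obj (A.S w.1)),
    y ∈ Set.range (Fw.map (m.fS w)) ↔ ∃ c : Shrink.{u} (π₀Obj (A.S w.1)),
      (⟨w.1, c⟩ : A.fibreData.total.Vertex) ∈ K.verts ∧
        y ∈ Set.range (Fw.map (A.vComp ⟨w.1, c⟩).1.arrow))
  (hmT : ∀ (e : H.toSemiGraph.Edge) (Fe : 𝒢.E e.1 ⥤ FintypeCat.{v₁}) [FiberFunctor Fe]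
      (x : Fe.obj (A.T e.1)),
    x ∈ Set.range (Fe.map (m.fT e)) ↔ ∃ c : Shrink.{u} (π₀Obj (A.T e.1)),
      (⟨e.1, c⟩ : A.fibreData.total.Edge) ∈ K.edges ∧
        x ∈ Set.range (Fe.map (A.eComp ⟨e.1, c⟩).1.arrow))

/-! ### Objects supported on `K` are extensions by initial objects -/

include hcl in
/-- An object `X ∈ B(𝒢_{A|_ℍ})` all of whose components off `K` are initial is isomorphic to the extension
by initial objects of its restriction to `K`, by an isomorphism whose restriction to `K` is the canonical
identification (`extendRestrictIso`). [cite: MochizukiSemiAnbd2006, Cor. 2.7(i) p.30] -/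
theorem exists_iso_extend (X : ((𝒢.restrictFunctor H).obj A).coveringGraph.BObj)
    (hS : ∀ vc : ((𝒢.restrictFunctor H).obj A).coveringGraph.graph.Vertex,
      (⟨vc.1.1, vc.2⟩ : A.fibreData.total.Vertex) ∉ K.verts → Nonempty (IsInitial (X.S vc)))
    (hT : ∀ ec : ((𝒢.restrictFunctor H).obj A).coveringGraph.graph.Edge,
      (⟨ec.1.1, ec.2⟩ : A.fibreData.total.Edge) ∉ K.edges → Nonempty (IsInitial (X.T ec))) :
    ∃ ν : X ≅ (A.extendFunctor H K hcl).obj ((A.reindexRestrict H K hV hE).obj X),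
      (A.reindexRestrict H K hV hE).map ν.hom =
        ((A.extendRestrictIso H K hV hE hcl).app ((A.reindexRestrict H K hV hE).obj X)).inv := by
  classical
  let D := (A.reindexRestrict H K hV hE).obj X
  -- the components of `ν`
  let eS : ∀ vc : ((𝒢.restrictFunctor H).obj A).coveringGraph.graph.Vertex,
      X.S vc ≅ A.extendS H K D vc := fun vc =>
    if hv : (⟨vc.1.1, vc.2⟩ : A.fibreData.total.Vertex) ∈ K.verts then
      (A.extendSIso H K D hv).symm
    else ((hS vc hv).some).uniqueUpToIso (A.isInitialExtendS H K D hv)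
  let eT : ∀ ec : ((𝒢.restrictFunctor H).obj A).coveringGraph.graph.Edge,
      X.T ec ≅ A.extendT H K D ec := fun ec =>
    if he : (⟨ec.1.1, ec.2⟩ : A.fibreData.total.Edge) ∈ K.edges then
      (A.extendTIso H K D he).symm
    else ((hT ec he).some).uniqueUpToIso (A.isInitialExtendT H K D he)
  have heS : ∀ (vc) (hv : (⟨vc.1.1, vc.2⟩ : A.fibreData.total.Vertex) ∈ K.verts),
      eS vc = (A.extendSIso H K D hv).symm := fun vc hv => dif_pos hv
  have heT : ∀ (ec) (he : (⟨ec.1.1, ec.2⟩ : A.fibreData.total.Edge) ∈ K.edges),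
      eT ec = (A.extendTIso H K D he).symm := fun ec he => dif_pos he
  refine ⟨BObj.isoMk eS eT (fun bc vc h => ?_), ?_⟩
  · -- compatibility with the gluing isomorphisms
    by_cases hv : (⟨vc.1.1, vc.2⟩ : A.fibreData.total.Vertex) ∈ K.verts
    · have he : (⟨𝒢.graph.edgeOf bc.1.1, bc.2⟩ : A.fibreData.total.Edge) ∈ K.edges := (hcl.1 bc vc h).mpr hv
      change _ ≫ (A.extendψ H K hcl D bc vc h).hom = _
      rw [heS vc hv, heT _ he, A.extendψ_of_mem H K hcl D bc vc h hv]
      simp only [Iso.trans_hom, Functor.mapIso_hom, Iso.symm_hom, Iso.map_inv_hom_id_assoc]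
      rfl
    · haveI := A.preservesColimit_empty_pull H bc vc h
      exact (((hS vc hv).some).isInitialObj
        (((𝒢.restrictFunctor H).obj A).coveringGraph.pull bc vc h).pullback).hom_ext _ _
  · -- on `K`, `ν` is the canonical identification
    refine BObj.hom_ext _ _ (funext fun kc => ?_) (funext fun ke => ?_)
    · change (eS (A.vK H K hV kc)).hom = (A.extendSIso H K D (vc := A.vK H K hV kc) kc.2).inv
      rw [heS (A.vK H K hV kc) kc.2]
      rfl
    · change (eT (A.eK H K hE ke)).hom = (A.extendTIso H K D (ec := A.eK H K hE ke) ke.2).inv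
      rw [heT (A.eK H K hE ke) ke.2]
      rfl

/-! ### A preimage component is clopen in the preimage -/

/-- A branch abutting in `𝔾_{A|_ℍ}` abuts in `𝔾_A`. [cite: MochizukiSemiAnbd2006, Cor. 2.7(i) p.30] -/
theorem total_abuts_of_abuts_restrictTotal {bc : ((𝒢.restrictFunctor H).obj A).coveringGraph.graph.Branch}
    {vc : ((𝒢.restrictFunctor H).obj A).coveringGraph.graph.Vertex}
    (h : ((𝒢.restrictFunctor H).obj A).coveringGraph.graph.abuts bc = some vc) :
    A.coveringGraph.graph.abuts ⟨bc.1.1, bc.2⟩ = some ⟨vc.1.1, vc.2⟩ := by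
  obtain ⟨⟨b, hb⟩, c'⟩ := bc
  obtain ⟨⟨v, hv0⟩, c⟩ := vc
  change (H.toSemiGraph.abuts ⟨b, hb⟩).pbind _ = some _ at h
  cases hb1 : H.toSemiGraph.abuts ⟨b, hb⟩ with
  | none => simp [hb1] at h
  | some w =>
    simp only [hb1, Option.pbind_some, Option.some.injEq] at h
    obtain ⟨hwv, hσ⟩ := Sigma.mk.inj_iff.mp h
    subst hwv
    have hG : 𝒢.graph.abuts b = some v := (SemiGraph.Subgraph.abuts_eq_some_iff H ⟨b, hb⟩ _).mp hb1
    change (𝒢.graph.abuts b).pbind _ = some _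
    simp only [hG, Option.pbind_some, Option.some.injEq]
    exact Sigma.ext rfl hσ

/-- **A preimage component of a sub-graph is clopen in the preimage**: along an abutting branch, the edge
lies in `K` iff the vertex does (abc-iut-L6-t17's incidence lemmas `mem_verts_of_abuts` /
`mem_edges_of_abuts`). [cite: MochizukiSemiAnbd2006, Cor. 2.7(i) p.30] -/
theorem isClopenIn_of_isPreimageComponent (hHg : H.toSemiGraph.IsGraph)
    (hK : A.coveringHomCan.IsPreimageComponent H K) : A.IsClopenIn H K := by
  refine ⟨fun bc vc h => ⟨fun he => ?_, fun hv => ?_⟩⟩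
  · exact hK.mem_verts_of_abuts (b := ⟨bc.1.1, bc.2⟩) he (A.total_abuts_of_abuts_restrictTotal H h)
  · exact hK.mem_edges_of_abuts A.fibreData.isProper_proj hHg hv
      (A.total_abuts_of_abuts_restrictTotal H h) bc.1.2

/-! ### `restrictComparison m` is full -/

include hcl hmS hmT in
/-- **`restrictComparison m : Over Z ⥤ B(𝒢_A|_K)` is full**: a morphism between the restrictions to `K`
extends (by initial objects) to a morphism of `B(𝒢_{A|_ℍ})` between the images under abc-iut-L3-t5's
fully faithful `toCovering`, hence comes from a morphism over `A|_ℍ`, which lies over `Z` (`m` mono).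
[cite: MochizukiSemiAnbd2006, Cor. 2.7(i) p.30] -/
theorem restrictComparison_full [Mono m] : (A.restrictComparison H K hV hE m).Full := by
  refine ⟨fun {Y Y'} k => ?_⟩
  haveI := ((𝒢.restrictFunctor H).obj A).toCovering_full
  haveI := ((𝒢.restrictFunctor H).obj A).toCovering_faithful
  -- the images of `Y`, `Y'` are supported on `K`
  obtain ⟨ν, hν⟩ := A.exists_iso_extend H K hV hE hcl
    (((𝒢.restrictFunctor H).obj A).toCovering.obj ((Over.map m).obj Y))
    (fun vc hvc => A.nonempty_isInitial_S_of_not_mem H K m hmS Y vc hvc)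
    (fun ec hec => A.nonempty_isInitial_T_of_not_mem H K m hmT Y ec hec)
  obtain ⟨ν', hν'⟩ := A.exists_iso_extend H K hV hE hcl
    (((𝒢.restrictFunctor H).obj A).toCovering.obj ((Over.map m).obj Y'))
    (fun vc hvc => A.nonempty_isInitial_S_of_not_mem H K m hmS Y' vc hvc)
    (fun ec hec => A.nonempty_isInitial_T_of_not_mem H K m hmT Y' ec hec)
  -- extend `k` by initial objects and pull it back through `toCovering`
  let kt : ((𝒢.restrictFunctor H).obj A).toCovering.obj ((Over.map m).obj Y) ⟶
      ((𝒢.restrictFunctor H).obj A).toCovering.obj ((Over.map m).obj Y') :=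
    ν.hom ≫ (A.extendFunctor H K hcl).map k ≫ ν'.inv
  let gt : (Over.map m).obj Y ⟶ (Over.map m).obj Y' :=
    ((𝒢.restrictFunctor H).obj A).toCovering.preimage kt
  have hgt : ((𝒢.restrictFunctor H).obj A).toCovering.map gt = kt := Functor.map_preimage _ _
  have hw : gt.left ≫ Y'.hom = Y.hom := by
    have h1 := Over.w gt
    rw [Over.map_obj_hom, Over.map_obj_hom, ← Category.assoc] at h1
    exact (cancel_mono m).mp h1
  refine ⟨Over.homMk gt.left hw, ?_⟩
  have hmap : (Over.map m).map (Over.homMk gt.left hw) = gt := Over.OverMorphism.ext rfl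
  change (A.reindexRestrict H K hV hE).map (((𝒢.restrictFunctor H).obj A).toCovering.map
    ((Over.map m).map (Over.homMk gt.left hw))) = k
  rw [hmap, hgt]
  change (A.reindexRestrict H K hV hE).map (ν.hom ≫ (A.extendFunctor H K hcl).map k ≫ ν'.inv) = k
  have hν'inv : (A.reindexRestrict H K hV hE).map ν'.inv =
      ((A.extendRestrictIso H K hV hE hcl).app _).hom := by
    rw [← cancel_mono ((A.reindexRestrict H K hV hE).map ν'.hom), ← Functor.map_comp, Iso.inv_hom_id,
      CategoryTheory.Functor.map_id, hν', Iso.hom_inv_id]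
  rw [Functor.map_comp, Functor.map_comp, hν, hν'inv]
  have hnat : (A.reindexRestrict H K hV hE).map ((A.extendFunctor H K hcl).map k) ≫
      (A.extendRestrictIso H K hV hE hcl).hom.app ((A.reindexRestrict H K hV hE).obj
        (((𝒢.restrictFunctor H).obj A).toCovering.obj ((Over.map m).obj Y'))) =
      (A.extendRestrictIso H K hV hE hcl).hom.app ((A.reindexRestrict H K hV hE).obj
        (((𝒢.restrictFunctor H).obj A).toCovering.obj ((Over.map m).obj Y))) ≫ k :=
    (A.extendRestrictIso H K hV hE hcl).hom.naturality k
  simp only [Iso.app_hom, Iso.app_inv]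
  rw [hnat, Iso.inv_hom_id_app_assoc]

/-- `(φ|_K)^* = φ_{A|_ℍ}^* ⋙ (restrict to K)` as functors. [cite: MochizukiSemiAnbd2006, Cor. 2.7(i) p.30] -/
theorem restrict_pullbackFunctor_eq :
    (A.coveringHomCan.restrict K H hV hE).pullbackFunctor =
      ((𝒢.restrictFunctor H).obj A).coveringHomCan.pullbackFunctor ⋙ A.reindexRestrict H K hV hE :=
  rfl

/-! ### `restrictComparison m` is essentially surjective -/

section EssSurj

variable [Mono m] [HasPullbacks (𝒢.restrict H).BObj]

include hcl hmS hmT in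
/-- **`restrictComparison m : Over Z ⥤ B(𝒢_A|_K)` is essentially surjective**: `D ∈ B(𝒢_A|_K)` extended
by initial objects is `toCovering (X̃ → A|_ℍ)` (abc-iut-L3-t5's essential surjectivity), and the base
change `X̃ ×_{A|_ℍ} Z → Z` is the required object over `Z` (counit inversion of part I).
[cite: MochizukiSemiAnbd2006, Cor. 2.7(i) p.30] -/
theorem restrictComparison_essSurj (hH : H.toSemiGraph.IsConnected) :
    (A.restrictComparison H K hV hE m).EssSurj := by
  refine ⟨fun D => ?_⟩
  haveI := ((𝒢.restrictFunctor H).obj A).toCovering_essSurj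
  let Xt : Over ((𝒢.restrictFunctor H).obj A) :=
    ((𝒢.restrictFunctor H).obj A).toCovering.objPreimage ((A.extendFunctor H K hcl).obj D)
  let e₁ : ((𝒢.restrictFunctor H).obj A).toCovering.obj Xt ≅ (A.extendFunctor H K hcl).obj D :=
    ((𝒢.restrictFunctor H).obj A).toCovering.objObjPreimageIso _
  haveI := A.isIso_reindexRestrict_map_counit H K hV hE m hmS hmT hH Xt
  exact ⟨(Over.pullback m).obj Xt,
    ⟨asIso ((A.reindexRestrict H K hV hE).map (((𝒢.restrictFunctor H).obj A).toCovering.map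
        ((Over.mapPullbackAdj m).counit.app Xt))) ≪≫
      (A.reindexRestrict H K hV hE).mapIso e₁ ≪≫ (A.extendRestrictIso H K hV hE hcl).app D⟩⟩

include hcl hmS hmT in
/-- **`restrictComparison m : B(𝒢_ℍ)_{/Z} ⥤ B(𝒢_A|_K)` is an equivalence of categories.**
[cite: MochizukiSemiAnbd2006, Cor. 2.7(i) p.30] -/
theorem restrictComparison_isEquivalence (hH : H.toSemiGraph.IsConnected) :
    (A.restrictComparison H K hV hE m).IsEquivalence :=
  haveI := A.restrictComparison_faithful H K hV hE m hmS hmT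
  haveI := A.restrictComparison_full H K hV hE hcl m hmS hmT
  haveI := A.restrictComparison_essSurj H K hV hE hcl m hmS hmT hH
  { }

/-! ### The global clause for `φ|_K` -/

include hmS hmT in
/-- After `toCovering` and restriction to `K`, the counit of `Over.map m ⊣ Over.pullback m` is a natural
ISOMORPHISM. [cite: MochizukiSemiAnbd2006, Cor. 2.7(i) p.30] -/
theorem isIso_whiskerRight_counit (hH : H.toSemiGraph.IsConnected) :
    IsIso (Functor.whiskerRight (Over.mapPullbackAdj m).counit
      (((𝒢.restrictFunctor H).obj A).toCovering ⋙ A.reindexRestrict H K hV hE)) := by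
  haveI : ∀ Y, IsIso ((Functor.whiskerRight (Over.mapPullbackAdj m).counit
      (((𝒢.restrictFunctor H).obj A).toCovering ⋙ A.reindexRestrict H K hV hE)).app Y) := fun Y =>
    A.isIso_reindexRestrict_map_counit H K hV hE m hmS hmT hH Y
  exact NatIso.isIso_of_isIso_app _

include hcl hmS hmT in
/-- **`φ|_K : 𝒢_A|_K → 𝒢_ℍ` is GLOBALLY the covering of `𝒢_ℍ` attached to `Z`**: there is an equivalence
`α : B(𝒢_ℍ)_{/Z} ⥲ B(𝒢_A|_K)` (namely `restrictComparison m`) with `(φ|_K)^* ≅ (Z × −) ⋙ α` — the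
hypothesis `Hom.IsGlobalCoveringOf` of the dictionary fact (D1) for the restricted covering
("`ℋ″ → ℍ`", [SemiAnbd] p. 30). [cite: MochizukiSemiAnbd2006, Cor. 2.7(i) p.30] -/
theorem restrict_isGlobalCoveringOf (hH : H.toSemiGraph.IsConnected) [HasBinaryProducts (𝒢.restrict H).BObj] :
    (A.coveringHomCan.restrict K H hV hE).IsGlobalCoveringOf Z := by
  haveI := A.isIso_whiskerRight_counit H K hV hE m hmS hmT hH
  refine ⟨inferInstance, A.restrictComparison H K hV hE m,
    A.restrictComparison_isEquivalence H K hV hE hcl m hmS hmT hH, ⟨?_⟩⟩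
  -- `(φ|_K)^* = φ_{A|_ℍ}^* ⋙ ρK ≅ (A|_ℍ × −) ⋙ toCovering ⋙ ρK`
  refine eqToIso (A.restrict_pullbackFunctor_eq H K hV hE) ≪≫
    Functor.isoWhiskerRight ((𝒢.restrictFunctor H).obj A).pullbackFunctorIsoStarComp
      (A.reindexRestrict H K hV hE) ≪≫ ?_
  -- `… ≅ (A|_ℍ × −) ⋙ (pullback m ⋙ map m) ⋙ toCovering ⋙ ρK` (counit inversion)
  refine Functor.isoWhiskerLeft (Over.star ((𝒢.restrictFunctor H).obj A))
      (asIso (Functor.whiskerRight (Over.mapPullbackAdj m).counit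
        (((𝒢.restrictFunctor H).obj A).toCovering ⋙ A.reindexRestrict H K hV hE))).symm ≪≫ ?_
  -- `… ≅ (Z × −) ⋙ map m ⋙ toCovering ⋙ ρK`
  exact Functor.isoWhiskerRight (Over.starPullbackIsoStar m)
    (Over.map m ⋙ ((𝒢.restrictFunctor H).obj A).toCovering ⋙ A.reindexRestrict H K hV hE)

end EssSurj

end BObj

end SemiGraphOfAnabelioids

end Literature.AnabelianGeometry.SemiGraphs
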